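import Summits.QuantumFields.BalabanUV.T4Continuum.Support.GaugeTermLayer

/-!
# T⁴ programme, spine node NE2 (U1a), tier B row B4.b — THE END THEOREM: `PerturbationLaws` for the gauge term
# `D_UP(U)D_U* − (∂P∂*) ⊗ 1` of the typed `Δ_a(U)`, from the two layers' numbers

ROUND-2 swarm `t4-ne2-formalise-*`, leaf prover 05, row **B4.b**, file 3b = the row's END (files 1 `GaugeTermSandwichLaw` p207779, 2a
`GaugeTermResolventBounds` p208240, 2b `GaugeTermTwoLevelNumbers` p208302, 3a `GaugeTermLayer`; row B4.a: `GaugeTermDecomposition` p207876,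
`GaugeTermSandwichBound` p208020).  THE B4 SUMMAND of the typed tier-B operator (skeleton `t4/SKELETON-NE2-P1.md` §2B, dictionary B0 as a
READING only, trigger c5): with the background family `(R, Q_U)` and the free family `(1, Q_1)` (same mass `a′`, same 0-form plantings `J₀`),
  `gaugeTerm k := gaugeP R Q_U a′ k − gaugeP 1 Q_1 a′ k = D_kP_U,kD_kᴴ − (∂⊗1)P_1,k(∂⊗1)ᴴ`
([Balaban1985BackgroundPropagators] (3.26) p. 395 «Δ_a = Δ + DRD* + Q*aQ», `R = 1 − P`, (3.25) p. 394; at `U = 1` [Balaban1984PropagatorsI]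
(1.69)/(1.70) p. 29–30 «Δ_a = Δ − ∂P∂* + aQ*Q»).  By `gaugeP_eq_sandwich` it is a DIFFERENCE OF TWO SANDWICH FAMILIES through the unit layer,
so `GaugeTermSandwichLaw.perturbationLaws_sandwich_sub` applies once both families have `SandwichLaws` (file 3a) and the differences
`‖Z_U − Z_1‖ ≤ δZ`, `‖N_U − N_1‖ ≤ δN` are numbers:
 * §1 `gaugeTerm`, `gaugeTerm_eq_sub_sandwich`.
 * §2 THE DIFFERENCES at one level from the layers' numbers and the transport size `‖Q_U,k − Q_1,k‖ ≤ τ` (row B3.a): **`opNorm_Zt_sub_le`**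
   (`δZ = τ√g + q·(2gα + gα + 2a′qτ·g√g)` via `opNorm_inv_mul_DH_sub_le` — NO Leibniz), **`opNorm_gramK_sub_le'`** (`δK`), and the unit-layer
   factor of the background family by Neumann around the free one (**`unitFactor_U`**: invertibility, `‖N_U‖ ≤ n₁(1 − n₁δK)⁻¹`,
   `‖N_U − N_1‖ ≤ n₁δK·n₁(1 − n₁δK)⁻¹`, `unitFactor_bounds`).
 * §3 **`perturbationLaws_gaugeTerm`**: `LayerLaws` of both families (rows B4.c/B4.d/B4.e/B4.f/B3.a/B5 supply the numbers) + the `U = 1` unit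
   datum (`K_1,k` invertible, `‖N_1,k‖ ≤ n₁`, row B4.c) + `n₁δK < 1` (small field) ⟹
   `PerturbationLaws (k ↦ calDalev k ⊗ₖ 1) gaugeTerm (k ↦ JpcT k ⊗ₖ 1) (Cst·(2·z·n_U·δZ + z·z·δN)) (k ↦ Esand … U k + Esand … 1 k)` — THE TARGET
   SHAPE of `t4/formal/NE2/LEAVES.md` for the B4 summand, with `z = q√g`, free defects `e₀ = 2dCst·L^{−k}`, `e₁ = CJ·L^{−k}` (`freeTowerLaws_king`,
   lifted by `freeTowerLaws_kron`).  The consistency constant is geometric as soon as the layers' two-level numbers are (file 1's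
   `Esand_le_geometric`); that bookkeeping and the `TowerLimitRate` corollary are left to the assembly B7 / a sequel.

HONEST FRAMING (T4-DAG p. 1).  Bookkeeping OURS; the only printed input is (1.89) via tree theorems; transporters, averagings, mass, plantings
and every number are DATA ∕ hypotheses (model level; no assertion of B0; GLOBAL small field `n₁δK < 1`); finite torus, linear layer, operator
norm; NOT [B9] (3.23)–(3.26) as printed (no Dirichlet regions, no multi-scale kernels); NE2 NOT proved — the row closes MODULO the named
numbers of rows B4.c ∕ B4.d ∕ B4.e ∕ B4.f ∕ B3.a ∕ B5 and NE3's consistency inside them (c2); NOT infinite volume, NOT a mass gap, NOT Clay,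
NOT summit progress; spine 0/9 unchanged.  HONEST DEPENDENCY: continuum YM on T⁴ ⇐ BetaPertH ∧ nine spine estimates (0/9 proved); BetaPertH ⇐
(D1) ∧ (D4) ∧ CAP+tail; G-an2-4 gates asym, D1 and NE2/3/4.  ABSOLUTE RULE kept; no `sorry`.
-/

noncomputable section

open scoped BigOperators ComplexConjugate Matrix Matrix.Norms.L2Operator Kronecker ComplexOrder

namespace Summit.QuantumFields.BalabanUV.T4Continuum.GaugeTermPerturbationLaw

open Literature.MathematicalPhysics.QuantumFieldTheory.Balaban1983to89.B5Prop11Plancherel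
open Literature.MathematicalPhysics.QuantumFieldTheory.Balaban1983to89.B5G183RateUnitTower (lev lev_neZero)
open Literature.MathematicalPhysics.QuantumFieldTheory.Balaban1983to89.B5Action121 (GradOp)
open Summit.QuantumFields.BalabanUV.T4Continuum
open Summit.QuantumFields.BalabanUV.T4Continuum.BalabanAveragedTowerUnit (idx calGlev one_le_lev' cast_lev')
open Summit.QuantumFields.BalabanUV.T4Continuum.BackgroundResolventTower
open Summit.QuantumFields.BalabanUV.T4Continuum.KingPairingPlantedLaw
open Summit.QuantumFields.BalabanUV.T4Continuum.KroneckerLift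
open Summit.QuantumFields.BalabanUV.T4Continuum.NE2PerturbedLayer (freeTowerLaws_king)
open Summit.QuantumFields.BalabanUV.T4Continuum.NE2ColourPerturbedLayer (inv_calDalev_kron opNorm_inv_calDalev_kron_le)
open Summit.QuantumFields.BalabanUV.T4Continuum.GaugeTermDecomposition (covGrad defect covGrad_eq covGrad_one defect_one sand)
open Summit.QuantumFields.BalabanUV.T4Continuum.GaugeTermSandwichBound (scalOp Zop Nop projP)
open Summit.QuantumFields.BalabanUV.T4Continuum.GaugeTermSandwichLaw
open Summit.QuantumFields.BalabanUV.T4Continuum.GaugeTermResolventBounds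
open Summit.QuantumFields.BalabanUV.T4Continuum.GaugeTermTwoLevelNumbers
open Summit.QuantumFields.BalabanUV.T4Continuum.GaugeTermLayer
open Summit.QuantumFields.BalabanUV.T4Continuum.PerturbationAlgebra (perturbationLaws_mono)

variable {d : ℕ} (L : ℕ) [NeZero L] (M : Fin d → ℕ) [hM : ∀ μ, NeZero (M μ)] (a : ℝ) (ha : 0 < a)
variable {o : Type*} [Fintype o] [DecidableEq o] {γ : Type*} [Fintype γ] [DecidableEq γ]

/-! ## §1 The B4 summand -/

/-- the trivial transporters `R ≡ 1` (the free family). [folklore] -/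
abbrev oneR : (k : ℕ) → Fin d → (Tor (fine (lev L k) M) → Matrix o o ℂ) := fun _ _ _ => 1

variable (R : (k : ℕ) → Fin d → (Tor (fine (lev L k) M) → Matrix o o ℂ)) (Qu Q₁ : (k : ℕ) → Matrix γ (Tor (fine (lev L k) M) × o) ℂ)
  (a' : ℝ) (J₀ : (k : ℕ) → Matrix (Tor (fine (lev L (k + 1)) M) × o) (Tor (fine (lev L k) M) × o) ℂ)

/-- **THE B4 SUMMAND** `gaugeTerm k = D_kP_{U,k}D_kᴴ − (∂ ⊗ 1)P_{1,k}(∂ ⊗ 1)ᴴ` — the gauge term of the background family minus the free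
one (zero at `R = 1`, `Q_U = Q_1` by construction; no assertion of the dictionary B0). [folklore] -/
def gaugeTerm (k : ℕ) : Matrix (idx L M k × o) (idx L M k × o) ℂ :=
  gaugeP L M R Qu a' k - gaugeP L M (oneR L M (o := o)) Q₁ a' k

/-- the B4 summand is a difference of two sandwich families. [folklore] -/
theorem gaugeTerm_eq_sub_sandwich (k : ℕ) :
    gaugeTerm L M R Qu Q₁ a' k
      = sandwich (Zt L M R Qu a') (Nt L M R Qu a') k - sandwich (Zt L M (oneR L M (o := o)) Q₁ a') (Nt L M (oneR L M (o := o)) Q₁ a') k := by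
  rw [gaugeTerm, gaugeP_eq_sandwich, gaugeP_eq_sandwich]

/-! ## §2 The differences at one level -/

section Diff

variable {L M a ha R Qu Q₁ a' J₀}

/-- the mass terms differ by the transport size: `‖a′Q_UᴴQ_U − a′Q_1ᴴQ_1‖ ≤ a′·τ·(q + q)`. [folklore] -/
theorem opNorm_mass_sub_le {q τ : ℝ} (ha' : 0 ≤ a') (k : ℕ) (hQu : ‖Qu k‖ ≤ q) (hQ₁ : ‖Q₁ k‖ ≤ q) (hτ : ‖Qu k - Q₁ k‖ ≤ τ) :
    ‖((a' : ℝ) : ℂ) • ((Qu k)ᴴ * Qu k) - ((a' : ℝ) : ℂ) • ((Q₁ k)ᴴ * Q₁ k)‖ ≤ a' * (τ * (q + q)) := by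
  have hq : 0 ≤ q := (norm_nonneg _).trans hQu
  rw [← smul_sub, norm_smul, Complex.norm_real, Real.norm_of_nonneg ha']
  refine mul_le_mul_of_nonneg_left ?_ ha'
  have h := opNorm_gramK_sub_le (Qu k)ᴴ (Q₁ k)ᴴ
  rw [Matrix.conjTranspose_conjTranspose, Matrix.conjTranspose_conjTranspose, ← Matrix.conjTranspose_sub,
    Matrix.l2_opNorm_conjTranspose, Matrix.l2_opNorm_conjTranspose, Matrix.l2_opNorm_conjTranspose] at h
  exact h.trans (mul_le_mul hτ (add_le_add hQu hQ₁) (add_nonneg (norm_nonneg _) (norm_nonneg _)) ((norm_nonneg _).trans hτ))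

/-- the size of `Z_U − Z_1` at one level: `δZ = τ·√g + q·(2gα + √g·α·√g + g·(a′τ(q+q))·√g)`. [folklore] -/
def deltaZ (g q α τ a' : ℝ) : ℝ :=
  τ * Real.sqrt g + q * (2 * g * α + Real.sqrt g * α * Real.sqrt g + g * (a' * (τ * (q + q))) * Real.sqrt g)

/-- **`‖Z_{U,k} − Z_{1,k}‖ ≤ δZ`** from the two layers' numbers and the transport size — via `opNorm_inv_mul_DH_sub_le` (no Leibniz).
[folklore] -/
theorem opNorm_Zt_sub_le {g q α α₁ τ : ℝ} {esu ecu θu q₁u es₁ ec₁ θ₁ q₁₁ : ℕ → ℝ}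
    (hu : LayerLaws L M a ha R Qu a' J₀ g q α esu ecu θu q₁u) (h₁ : LayerLaws L M a ha (oneR L M (o := o)) Q₁ a' J₀ g q α₁ es₁ ec₁ θ₁ q₁₁)
    (hτ : ∀ k, ‖Qu k - Q₁ k‖ ≤ τ) (k : ℕ) :
    ‖Zt L M R Qu a' k - Zt L M (oneR L M (o := o)) Q₁ a' k‖ ≤ deltaZ g q α τ a' := by
  have hq : 0 ≤ q := hu.nonneg.2.1
  -- the Gram-plus-positive presentations of the two scalar operators
  have hS₁ : Sop L M (oneR L M (o := o)) Q₁ a' k = (GradOp (fine (lev L k) M) (cl L k) ⊗ₖ (1 : Matrix o o ℂ))ᴴ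
      * (GradOp (fine (lev L k) M) (cl L k) ⊗ₖ (1 : Matrix o o ℂ)) + ((a' : ℝ) : ℂ) • ((Q₁ k)ᴴ * Q₁ k) := by
    rw [Sop_eq, covGrad_one]
  have hSu : Sop L M R Qu a' k = (GradOp (fine (lev L k) M) (cl L k) ⊗ₖ (1 : Matrix o o ℂ) + defect (fine (lev L k) M) (cl L k) (R k))ᴴ
      * (GradOp (fine (lev L k) M) (cl L k) ⊗ₖ (1 : Matrix o o ℂ) + defect (fine (lev L k) M) (cl L k) (R k))
      + ((a' : ℝ) : ℂ) • ((Qu k)ᴴ * Qu k) := by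
    rw [Sop_eq, covGrad_eq]
  have hB := opNorm_inv_mul_DH_sub_le hS₁ hSu (massTerm_posSemidef a' hu.nonneg.1 (Q₁ k)) (massTerm_posSemidef a' hu.nonneg.1 (Qu k))
    (h₁.isUnit_S k) (hu.isUnit_S k) (h₁.opNorm_G_le k) (hu.opNorm_G_le k) (hu.opNorm_defect_le k)
    (opNorm_mass_sub_le hu.nonneg.1 k (hu.opNorm_Q_le k) (h₁.opNorm_Q_le k) (hτ k))
  -- `Z = Q·(G′Dᴴ)`
  have eU : Zt L M R Qu a' k = Qu k * (Gop L M R Qu a' k * (GradOp (fine (lev L k) M) (cl L k) ⊗ₖ (1 : Matrix o o ℂ)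
      + defect (fine (lev L k) M) (cl L k) (R k))ᴴ) := by
    rw [Zt, Zop, Matrix.mul_assoc, covGrad_eq]
  have e₁ : Zt L M (oneR L M (o := o)) Q₁ a' k = Q₁ k * (Gop L M (oneR L M (o := o)) Q₁ a' k
      * (GradOp (fine (lev L k) M) (cl L k) ⊗ₖ (1 : Matrix o o ℂ))ᴴ) := by
    rw [Zt, Zop, Matrix.mul_assoc, covGrad_one]
  rw [eU, e₁]
  refine (opNorm_mul_sub_mul_le _ _ _ _).trans ?_
  have hA : ‖Gop L M R Qu a' k * (GradOp (fine (lev L k) M) (cl L k) ⊗ₖ (1 : Matrix o o ℂ) + defect (fine (lev L k) M) (cl L k) (R k))ᴴ‖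
      ≤ Real.sqrt g := by
    have h := opNorm_G_mul_covGradH_le hu k
    rwa [covGrad_eq] at h
  unfold deltaZ
  exact add_le_add (mul_le_mul (hτ k) hA (norm_nonneg _) ((norm_nonneg _).trans (hτ k))) (mul_le_mul (h₁.opNorm_Q_le k) hB (norm_nonneg _) hq)

/-- the size of `K_U − K_1` at one level: `δK = (τg + q·(√g·α·g + g·α·√g + g·(a′τ(q+q))·g))·(qg + qg)`. [folklore] -/
def deltaK (g q α τ a' : ℝ) : ℝ :=
  (τ * g + q * (Real.sqrt g * α * g + g * α * Real.sqrt g + g * (a' * (τ * (q + q))) * g)) * (q * g + q * g)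

/-- **`‖K_{U,k} − K_{1,k}‖ ≤ δK`** for the unit-layer Grams `K = (QG′)(QG′)ᴴ`, via `opNorm_inv_sub_inv_le_gram`. [folklore] -/
theorem opNorm_gramK_U_sub_le {g q α α₁ τ : ℝ} {esu ecu θu q₁u es₁ ec₁ θ₁ q₁₁ : ℕ → ℝ}
    (hu : LayerLaws L M a ha R Qu a' J₀ g q α esu ecu θu q₁u) (h₁ : LayerLaws L M a ha (oneR L M (o := o)) Q₁ a' J₀ g q α₁ es₁ ec₁ θ₁ q₁₁)
    (hτ : ∀ k, ‖Qu k - Q₁ k‖ ≤ τ) (k : ℕ) :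
    ‖(Qu k * Gop L M R Qu a' k) * (Qu k * Gop L M R Qu a' k)ᴴ
        - (Q₁ k * Gop L M (oneR L M (o := o)) Q₁ a' k) * (Q₁ k * Gop L M (oneR L M (o := o)) Q₁ a' k)ᴴ‖ ≤ deltaK g q α τ a' := by
  have hq : 0 ≤ q := hu.nonneg.2.1
  have hg : 0 ≤ g := (norm_nonneg _).trans (hu.opNorm_G_le 0)
  have hS₁ : Sop L M (oneR L M (o := o)) Q₁ a' k = (GradOp (fine (lev L k) M) (cl L k) ⊗ₖ (1 : Matrix o o ℂ))ᴴ
      * (GradOp (fine (lev L k) M) (cl L k) ⊗ₖ (1 : Matrix o o ℂ)) + ((a' : ℝ) : ℂ) • ((Q₁ k)ᴴ * Q₁ k) := by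
    rw [Sop_eq, covGrad_one]
  have hSu : Sop L M R Qu a' k = (GradOp (fine (lev L k) M) (cl L k) ⊗ₖ (1 : Matrix o o ℂ) + defect (fine (lev L k) M) (cl L k) (R k))ᴴ
      * (GradOp (fine (lev L k) M) (cl L k) ⊗ₖ (1 : Matrix o o ℂ) + defect (fine (lev L k) M) (cl L k) (R k))
      + ((a' : ℝ) : ℂ) • ((Qu k)ᴴ * Qu k) := by
    rw [Sop_eq, covGrad_eq]
  have hG : ‖Gop L M R Qu a' k - Gop L M (oneR L M (o := o)) Q₁ a' k‖
      ≤ Real.sqrt g * α * g + g * α * Real.sqrt g + g * (a' * (τ * (q + q))) * g :=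
    opNorm_inv_sub_inv_le_gram hS₁ hSu (massTerm_posSemidef a' hu.nonneg.1 (Q₁ k)) (massTerm_posSemidef a' hu.nonneg.1 (Qu k))
      (h₁.isUnit_S k) (hu.isUnit_S k) (h₁.opNorm_G_le k) (hu.opNorm_G_le k) (hu.opNorm_defect_le k)
      (opNorm_mass_sub_le hu.nonneg.1 k (hu.opNorm_Q_le k) (h₁.opNorm_Q_le k) (hτ k))
  have hY : ‖Qu k * Gop L M R Qu a' k - Q₁ k * Gop L M (oneR L M (o := o)) Q₁ a' k‖
      ≤ τ * g + q * (Real.sqrt g * α * g + g * α * Real.sqrt g + g * (a' * (τ * (q + q))) * g) :=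
    (opNorm_mul_sub_mul_le _ _ _ _).trans (add_le_add (mul_le_mul (hτ k) (hu.opNorm_G_le k) (norm_nonneg _) ((norm_nonneg _).trans (hτ k)))
      (mul_le_mul (h₁.opNorm_Q_le k) hG (norm_nonneg _) hq))
  refine (opNorm_gramK_sub_le _ _).trans ?_
  unfold deltaK
  exact mul_le_mul hY (add_le_add (opNorm_Y_le hu k) (opNorm_Y_le h₁ k)) (add_nonneg (norm_nonneg _) (norm_nonneg _))
    ((norm_nonneg _).trans hY)

/-- **THE BACKGROUND FAMILY'S UNIT-LAYER FACTOR BY NEUMANN AROUND THE FREE ONE**: with the `U = 1` datum (`K_{1,k}` invertible,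
`‖N_{1,k}‖ ≤ n₁`, row B4.c) and the small-field condition `n₁δK < 1`: every `K_{U,k}` is invertible, `‖N_{U,k}‖ ≤ n₁(1 − n₁δK)⁻¹` and
`‖N_{U,k} − N_{1,k}‖ ≤ n₁·δK·n₁·(1 − n₁δK)⁻¹`. [folklore] -/
theorem unitFactor_U {g q α α₁ τ n₁ : ℝ} {esu ecu θu q₁u es₁ ec₁ θ₁ q₁₁ : ℕ → ℝ}
    (hu : LayerLaws L M a ha R Qu a' J₀ g q α esu ecu θu q₁u) (h₁ : LayerLaws L M a ha (oneR L M (o := o)) Q₁ a' J₀ g q α₁ es₁ ec₁ θ₁ q₁₁)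
    (hτ : ∀ k, ‖Qu k - Q₁ k‖ ≤ τ)
    (hK₁ : ∀ k, IsUnit (Q₁ k * Gop L M (oneR L M (o := o)) Q₁ a' k * Gop L M (oneR L M (o := o)) Q₁ a' k * (Q₁ k)ᴴ).det)
    (hn₁ : ∀ k, ‖Nt L M (oneR L M (o := o)) Q₁ a' k‖ ≤ n₁) (hsmall : n₁ * deltaK g q α τ a' < 1) (k : ℕ) :
    IsUnit (Qu k * Gop L M R Qu a' k * Gop L M R Qu a' k * (Qu k)ᴴ).det
      ∧ ‖Nt L M R Qu a' k‖ ≤ n₁ * (1 - n₁ * deltaK g q α τ a')⁻¹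
      ∧ ‖Nt L M R Qu a' k - Nt L M (oneR L M (o := o)) Q₁ a' k‖ ≤ n₁ * deltaK g q α τ a' * n₁ * (1 - n₁ * deltaK g q α τ a')⁻¹ := by
  have hK₁' : IsUnit ((Q₁ k * Gop L M (oneR L M (o := o)) Q₁ a' k) * (Q₁ k * Gop L M (oneR L M (o := o)) Q₁ a' k)ᴴ).det := by
    rw [← gramK_eq]; exact hK₁ k
  have hn₁' : ‖((Q₁ k * Gop L M (oneR L M (o := o)) Q₁ a' k) * (Q₁ k * Gop L M (oneR L M (o := o)) Q₁ a' k)ᴴ)⁻¹‖ ≤ n₁ := by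
    rw [← Nt_eq]; exact hn₁ k
  obtain ⟨hU, hN, hd⟩ := unitFactor_bounds hK₁' hn₁' (opNorm_gramK_U_sub_le hu h₁ hτ k) hsmall
  refine ⟨by rw [gramK_eq]; exact hU, by rw [Nt_eq]; exact hN, ?_⟩
  rw [Nt_eq, Nt_eq]; exact hd

end Diff

/-! ## §3 The END theorem of row B4.b -/

/-- the relative bound of the B4 summand: `κ₄ = Cst·(2·z·n_U·δZ + z·z·δN)`, `z = q√g`, `n_U = n₁(1 − n₁δK)⁻¹`, `δN = n₁δK·n_U`. [folklore] -/
def kappaGT (d : ℕ) (a g q α τ a' n₁ : ℝ) : ℝ :=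
  Cst d a * (2 * (q * Real.sqrt g) * (n₁ * (1 - n₁ * deltaK g q α τ a')⁻¹) * deltaZ g q α τ a'
    + (q * Real.sqrt g) * (q * Real.sqrt g) * (n₁ * deltaK g q α τ a' * n₁ * (1 - n₁ * deltaK g q α τ a')⁻¹))

/-- the consistency constant of the B4 summand: the two families' `Esand` against the free defects `e₀ = 2dCst·L^{−k}`, `e₁ = CJ·L^{−k}`.
[folklore] -/
def EGT (d L : ℕ) (a g q α τ a' n₁ : ℝ) (esu ecu θu q₁u es₁ ec₁ θ₁ q₁₁ : ℕ → ℝ) (k : ℕ) : ℝ :=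
  Esand (Cst d a) (q * Real.sqrt g) (n₁ * (1 - n₁ * deltaK g q α τ a')⁻¹) (fun k => 2 * d * Cst d a * ((L : ℝ)⁻¹) ^ k)
      (fun k => CJ d a * ((L : ℝ)⁻¹) ^ k) (zetaL d a g q α esu θu q₁u) (nuL g q (n₁ * (1 - n₁ * deltaK g q α τ a')⁻¹) esu ecu q₁u) k
    + Esand (Cst d a) (q * Real.sqrt g) (n₁ * (1 - n₁ * deltaK g q α τ a')⁻¹) (fun k => 2 * d * Cst d a * ((L : ℝ)⁻¹) ^ k)
      (fun k => CJ d a * ((L : ℝ)⁻¹) ^ k) (zetaL d a g q α es₁ θ₁ q₁₁) (nuL g q (n₁ * (1 - n₁ * deltaK g q α τ a')⁻¹) es₁ ec₁ q₁₁) k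

/-- **ROW B4.b — `PerturbationLaws` FOR THE GAUGE TERM.**  For a background family `(R, Q_U)` and the free family `(1, Q_1)` with
`LayerLaws` (numbers from rows B4.c ∕ B4.d ∕ B4.e ∕ B4.f ∕ B3.a ∕ B5; the free family's defect number may be taken `= α` as an upper
bound), the `U = 1` unit datum (`K_{1,k}` invertible, `‖N_{1,k}‖ ≤ n₁`) and the small-field condition `n₁·δK < 1`:
`PerturbationLaws (k ↦ Δ_a^{(k)} ⊗ 1) gaugeTerm (k ↦ J_k ⊗ 1) κ₄ E₄` — THE TARGET SHAPE of the NE2 tier-B table for the B4 summand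
(consumed by the assembly B7 via `perturbationLaws_add`).  NOT NE2; model level; statement and constants OURS. [folklore] -/
theorem perturbationLaws_gaugeTerm {g q α τ n₁ : ℝ} {esu ecu θu q₁u es₁ ec₁ θ₁ q₁₁ : ℕ → ℝ}
    (hu : LayerLaws L M a ha R Qu a' J₀ g q α esu ecu θu q₁u) (h₁ : LayerLaws L M a ha (oneR L M (o := o)) Q₁ a' J₀ g q α es₁ ec₁ θ₁ q₁₁)
    (hτ : ∀ k, ‖Qu k - Q₁ k‖ ≤ τ)
    (hK₁ : ∀ k, IsUnit (Q₁ k * Gop L M (oneR L M (o := o)) Q₁ a' k * Gop L M (oneR L M (o := o)) Q₁ a' k * (Q₁ k)ᴴ).det)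
    (hn₁ : ∀ k, ‖Nt L M (oneR L M (o := o)) Q₁ a' k‖ ≤ n₁) (hsmall : n₁ * deltaK g q α τ a' < 1) :
    PerturbationLaws (fun k => calDalev L M a ha k ⊗ₖ (1 : Matrix o o ℂ)) (gaugeTerm L M R Qu Q₁ a')
      (fun k => JpcT L M k ⊗ₖ (1 : Matrix o o ℂ)) (kappaGT d a g q α τ a' n₁) (EGT d L a g q α τ a' n₁ esu ecu θu q₁u es₁ ec₁ θ₁ q₁₁) := by
  have hn₁0 : 0 ≤ n₁ := (norm_nonneg _).trans (hn₁ 0)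
  have hν : 1 ≤ (1 - n₁ * deltaK g q α τ a')⁻¹ := by
    have hδ : 0 ≤ n₁ * deltaK g q α τ a' := mul_nonneg hn₁0 ((norm_nonneg _).trans (opNorm_gramK_U_sub_le hu h₁ hτ 0))
    exact (one_le_inv₀ (by linarith)).mpr (by linarith)
  -- the unit-layer data of both families with the common bound `n_U = n₁(1 − n₁δK)⁻¹`
  have hKu := fun k => (unitFactor_U hu h₁ hτ hK₁ hn₁ hsmall k).1
  have hNu := fun k => (unitFactor_U hu h₁ hτ hK₁ hn₁ hsmall k).2.1
  have hN₁ : ∀ k, ‖Nt L M (oneR L M (o := o)) Q₁ a' k‖ ≤ n₁ * (1 - n₁ * deltaK g q α τ a')⁻¹ := fun k =>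
    (hn₁ k).trans (le_mul_of_one_le_right hn₁0 hν)
  have hdN := fun k => (unitFactor_U hu h₁ hτ hK₁ hn₁ hsmall k).2.2
  have hSu := sandwichLaws_of_layerLaws hu hKu hNu
  have hS₁ := sandwichLaws_of_layerLaws h₁ hK₁ hN₁
  have hfree := freeTowerLaws_kron o (freeTowerLaws_king L M a ha)
  have hlaw := perturbationLaws_sandwich_sub hfree (opNorm_inv_calDalev_kron_le L M a ha) (inv_kron_conjTranspose L M a ha) hSu hS₁
    (opNorm_Zt_sub_le hu h₁ hτ) hdN
  have e : gaugeTerm L M R Qu Q₁ a' = fun k => sandwich (Zt L M R Qu a') (Nt L M R Qu a') k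
      - sandwich (Zt L M (oneR L M (o := o)) Q₁ a') (Nt L M (oneR L M (o := o)) Q₁ a') k :=
    funext fun k => gaugeTerm_eq_sub_sandwich L M R Qu Q₁ a' k
  rw [e]
  exact perturbationLaws_mono hlaw (le_of_eq (by rfl)) fun k => le_of_eq (by rfl)

end Summit.QuantumFields.BalabanUV.T4Continuum.GaugeTermPerturbationLaw

end
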